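import Mathlib

/-!
# Stub `stub_rateBookkeeping` for the crux `WeakCouplingHypercubicLimit` (line `Sketch`)

Pure real-analysis bookkeeping closing the trace-norm / cold-pressure line.  On the discrete
torus of half-side `S` (side `N = 2S+1`), with rate `μ ∈ [0, 1]`, time-width `w ≤ n ≤ S`,
`2w ≤ S`, nonnegative trace excesses `X` obeying the cold-pressure bound `X m ≤ C₀ V e^{-μ m}`
whenever `2m ≥ S + 1`, and the volume floor `C₀ V e^{-μ S/2} ≤ K`, the output of the trace
cluster bound at `r = e^{-μ}` with exponents `a = 2S+1-n-w`, `b = n-w`, `p = q = 2S+1-w`,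
`N = 2S+1` is at most `C_A C_B e^{2w} (2 + 4K + K²) e^{-μ n}`.

Proof: write `E = e^{-μ n}`, `G = e^{w}`.  From `0 ≤ X (S+1) ≤ C₀ V e^{-μ (S+1)}` one gets
`0 ≤ C₀ V`, hence `0 ≤ K` and, for `2m ≥ S+1`, `X m ≤ K e^{-μ (m - S/2)}`.  The six terms are then
bounded by `G E (1 + K)`, `G E`, `K E`, `K G E`, `K G E`, `K² G² E` respectively, and summed using
`1 ≤ G`, `E ≤ 1`.
-/

noncomputable section

namespace Summit.QuantumFields.YangMills.Theorems.WeakCouplingHypercubicLimit.TraceNormColdPressure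

/-- `stub_rateBookkeeping` (S5) — **real-analysis bookkeeping**: on the torus of half-side `S`, with
`μ = Δ a_k ∈ [0, 1]`, width `w ≤ n ≤ S`, `2w ≤ S`, trace excesses `X ≥ 0` obeying the cold-pressure
bound `X m ≤ C₀ V e^{−μ m}` for `2m ≥ S + 1` and the volume floor `C₀ V e^{−μ S/2} ≤ K`, the output of
the trace cluster bound at `r = e^{−μ}`, exponents `(2S+1−n−w, n−w, 2S+1−w, 2S+1−w, 2S+1)`, is at most
`C_A C_B e^{2w} (2 + 4K + K²) e^{−μ n}`. -/
theorem stub_rateBookkeeping :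
    ∀ (μ C₀ V K CA CB : ℝ) (X : ℕ → ℝ) (S n w : ℕ), 0 ≤ μ → μ ≤ 1 → 0 ≤ CA → 0 ≤ CB →
      w ≤ n → n ≤ S → 2 * w ≤ S → (∀ m, 0 ≤ X m) →
      (∀ m : ℕ, S + 1 ≤ 2 * m → X m ≤ C₀ * V * Real.exp (-(μ * m))) →
      C₀ * V * Real.exp (-(μ * S / 2)) ≤ K →
      CA * CB * (Real.exp (-μ) ^ (n - w) * (1 + X (2 * S + 1 - n - w)) +
          Real.exp (-μ) ^ (2 * S + 1 - n - w) + X (2 * S + 1) + X (2 * S + 1 - w) + X (2 * S + 1 - w) +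
          X (2 * S + 1 - w) * X (2 * S + 1 - w)) ≤
        CA * CB * Real.exp (2 * w) * (2 + 4 * K + K ^ 2) * Real.exp (-(μ * n)) := by
  intro μ C₀ V K CA CB X S n w hμ0 hμ1 hCA hCB hwn hnS h2wS hX0 hXb hK
  -- name the guarded natural-number differences `d = n - w`, `a = 2S+1-n-w`, `p = 2S+1-w`
  obtain ⟨d, hd⟩ : ∃ d : ℕ, n = w + d := ⟨n - w, by omega⟩
  obtain ⟨a, ha⟩ : ∃ a : ℕ, 2 * S + 1 = a + n + w := ⟨2 * S + 1 - n - w, by omega⟩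
  obtain ⟨p, hp⟩ : ∃ p : ℕ, 2 * S + 1 = p + w := ⟨2 * S + 1 - w, by omega⟩
  have h1 : n - w = d := by omega
  have h2 : 2 * S + 1 - n - w = a := by omega
  have h3 : 2 * S + 1 - w = p := by omega
  rw [h1, h2, h3]
  -- real-valued forms of the arithmetic hypotheses
  have hdR : (n : ℝ) = w + d := by exact_mod_cast hd
  have haR : (2 * S + 1 : ℝ) = a + n + w := by exact_mod_cast ha
  have hpR : (2 * S + 1 : ℝ) = p + w := by exact_mod_cast hp
  have hnSR : (n : ℝ) ≤ S := by exact_mod_cast hnS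
  have h2wSR : 2 * (w : ℝ) ≤ S := by exact_mod_cast h2wS
  have hw0 : (0 : ℝ) ≤ w := Nat.cast_nonneg w
  have hS0 : (0 : ℝ) ≤ S := Nat.cast_nonneg S
  have hμw : μ * w ≤ w := mul_le_of_le_one_left hw0 hμ1
  -- the two basic exponentials `E = e^{-μ n}` and `G = e^{w}`
  have hE0 : 0 ≤ Real.exp (-(μ * n)) := (Real.exp_pos _).le
  have hE1 : Real.exp (-(μ * n)) ≤ 1 := by
    rw [Real.exp_le_one_iff, neg_nonpos]
    exact mul_nonneg hμ0 (Nat.cast_nonneg n)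
  have hG0 : 0 ≤ Real.exp (w : ℝ) := (Real.exp_pos _).le
  have hG1 : 1 ≤ Real.exp (w : ℝ) := Real.one_le_exp hw0
  have hG2 : Real.exp (2 * (w : ℝ)) = Real.exp (w : ℝ) ^ 2 := by
    rw [sq, ← Real.exp_add]; congr 1; ring
  -- sign of `C₀ V` and of `K`
  have hCV : 0 ≤ C₀ * V := by
    have h3 : 0 ≤ C₀ * V * Real.exp (-(μ * ((S + 1 : ℕ) : ℝ))) :=
      le_trans (hX0 (S + 1)) (hXb (S + 1) (by omega))
    exact (mul_nonneg_iff_of_pos_right (Real.exp_pos _)).mp h3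
  have hK0 : 0 ≤ K := le_trans (mul_nonneg hCV (Real.exp_pos _).le) hK
  -- cold pressure transported through the volume floor
  have hXK : ∀ m : ℕ, S + 1 ≤ 2 * m → X m ≤ K * Real.exp (-(μ * ((m : ℝ) - S / 2))) := by
    intro m hm
    have hsplit : Real.exp (-(μ * m)) =
        Real.exp (-(μ * S / 2)) * Real.exp (-(μ * ((m : ℝ) - S / 2))) := by
      rw [← Real.exp_add]; congr 1; ring
    calc X m ≤ C₀ * V * Real.exp (-(μ * m)) := hXb m hm
      _ = C₀ * V * Real.exp (-(μ * S / 2)) * Real.exp (-(μ * ((m : ℝ) - S / 2))) := by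
          rw [hsplit]; ring
      _ ≤ K * Real.exp (-(μ * ((m : ℝ) - S / 2))) :=
          mul_le_mul_of_nonneg_right hK (Real.exp_pos _).le
  -- `e^{-μ d} = e^{μ w} e^{-μ n} ≤ G E`
  have hEd : Real.exp (-(μ * d)) ≤ Real.exp (w : ℝ) * Real.exp (-(μ * n)) := by
    have : Real.exp (-(μ * d)) = Real.exp (μ * w) * Real.exp (-(μ * n)) := by
      rw [← Real.exp_add]; congr 1; rw [hdR]; ring
    rw [this]
    exact mul_le_mul_of_nonneg_right (Real.exp_le_exp.mpr hμw) hE0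
  -- term 1 prefactor `e^{-μ}^d ≤ G E`
  have hB1 : Real.exp (-μ) ^ d ≤ Real.exp (w : ℝ) * Real.exp (-(μ * n)) := by
    have : Real.exp (-μ) ^ d = Real.exp (-(μ * d)) := by
      rw [← Real.exp_nat_mul]; congr 1; ring
    rw [this]; exact hEd
  -- `X a ≤ K`
  have hXa : X a ≤ K := by
    have h := hXK a (by omega)
    have hle : Real.exp (-(μ * ((a : ℝ) - S / 2))) ≤ 1 := by
      rw [Real.exp_le_one_iff, neg_nonpos]
      exact mul_nonneg hμ0 (by linarith)
    exact h.trans (mul_le_of_le_one_right hK0 hle)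
  -- term 1
  have hT1 : Real.exp (-μ) ^ d * (1 + X a) ≤
      Real.exp (w : ℝ) * Real.exp (-(μ * n)) * (1 + K) :=
    mul_le_mul hB1 (by linarith) (by linarith [hX0 a]) (mul_nonneg hG0 hE0)
  -- term 2
  have hT2 : Real.exp (-μ) ^ a ≤ Real.exp (w : ℝ) * Real.exp (-(μ * n)) := by
    have hda : d ≤ a := by omega
    have he1 : Real.exp (-μ) ≤ 1 := by
      rw [Real.exp_le_one_iff, neg_nonpos]; exact hμ0
    exact (pow_le_pow_of_le_one (Real.exp_pos _).le he1 hda).trans hB1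
  -- term 3
  have hT3 : X (2 * S + 1) ≤ K * Real.exp (-(μ * n)) := by
    refine (hXK (2 * S + 1) (by omega)).trans (mul_le_mul_of_nonneg_left ?_ hK0)
    refine Real.exp_le_exp.mpr (neg_le_neg (mul_le_mul_of_nonneg_left ?_ hμ0))
    push_cast
    linarith
  -- terms 4 and 5
  have hT4 : X p ≤ K * (Real.exp (w : ℝ) * Real.exp (-(μ * n))) := by
    refine (hXK p (by omega)).trans (mul_le_mul_of_nonneg_left ?_ hK0)
    refine le_trans (Real.exp_le_exp.mpr (neg_le_neg (mul_le_mul_of_nonneg_left ?_ hμ0))) hEd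
    linarith
  -- term 6
  have hT6 : X p * X p ≤ K ^ 2 * Real.exp (w : ℝ) ^ 2 * Real.exp (-(μ * n)) := by
    have h := mul_le_mul hT4 hT4 (hX0 p) (mul_nonneg hK0 (mul_nonneg hG0 hE0))
    calc X p * X p ≤ K * (Real.exp (w : ℝ) * Real.exp (-(μ * n))) *
          (K * (Real.exp (w : ℝ) * Real.exp (-(μ * n)))) := h
      _ = K ^ 2 * Real.exp (w : ℝ) ^ 2 * Real.exp (-(μ * n)) * Real.exp (-(μ * n)) := by ring
      _ ≤ K ^ 2 * Real.exp (w : ℝ) ^ 2 * Real.exp (-(μ * n)) :=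
          mul_le_of_le_one_right (by positivity) hE1
  -- `G E ≤ G² E` and `E ≤ G² E`
  have hGE : Real.exp (w : ℝ) * Real.exp (-(μ * n)) ≤
      Real.exp (w : ℝ) ^ 2 * Real.exp (-(μ * n)) := by
    have := mul_nonneg (mul_nonneg hG0 hE0) (sub_nonneg.mpr hG1)
    linarith only [this]
  have hE2 : Real.exp (-(μ * n)) ≤ Real.exp (w : ℝ) ^ 2 * Real.exp (-(μ * n)) := by
    have := mul_nonneg hE0 (sub_nonneg.mpr hG1)
    linarith only [this, hGE]
  -- assemble the six terms
  have key : Real.exp (-μ) ^ d * (1 + X a) + Real.exp (-μ) ^ a + X (2 * S + 1) + X p + X p +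
      X p * X p ≤ Real.exp (w : ℝ) ^ 2 * (2 + 4 * K + K ^ 2) * Real.exp (-(μ * n)) := by
    have i1 := mul_le_mul_of_nonneg_right hGE (by linarith : (0 : ℝ) ≤ 1 + K)
    have i2 := mul_le_mul_of_nonneg_left hE2 hK0
    have i3 := mul_le_mul_of_nonneg_left hGE hK0
    linarith only [hT1, hT2, hT3, hT4, hT6, i1, i2, i3, hGE]
  calc _ ≤ CA * CB * (Real.exp (w : ℝ) ^ 2 * (2 + 4 * K + K ^ 2) * Real.exp (-(μ * n))) :=
        mul_le_mul_of_nonneg_left key (mul_nonneg hCA hCB)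
    _ = _ := by rw [hG2]; ring

end Summit.QuantumFields.YangMills.Theorems.WeakCouplingHypercubicLimit.TraceNormColdPressure

end
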